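import Summits.QuantumFields.BalabanUV.T4Continuum.Support.G183KernelRates
import Literature.Probability.LatticeModels.LatticeGreenAsymptotics

/-!
# G183FreePartOneDim — part 1/5 of the proof of `G183KernelRates.FreePartRate` (the η-rate of the FREE PART of Bałaban's
# (1.83) propagator at `U = 1`): the one-dimensional heat-kernel inputs with ONE exponential weight kept (§1) and the
# level-`l` kernels in physical variables against the level-free Gaussian `Φ_t` (§2)

Cell `pub-balaban`, T4-DAG §5 node U1a, spine estimate NE2, prover P2, lineage t4-ne2-p2 gen 8, row T4-U1a.E-NE2-PROVE-P2h*.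
HONEST FRAMING: rung (B)+1 bookkeeping for the LINEAR theory at `U = 1` on the infinite fine lattices `(1/n)ℤ^{d+1}`; NOT the
torus, NOT `U ≠ 1`, NOT infinite-volume physics, NOT a mass gap, NOT Clay.  Inputs: Mathlib and kernel-proved tree theorems BY
NAME (`Literature.Probability.LatticeModels.*` after Lawler–Limic 2010 [LawlerLimic2010]; `G183KernelRates` gen 7); nothing
printed in the audited papers is a hypothesis; no `def … : Prop` is assumed; no `sorry`.  All namespace
`Summit.QuantumFields.BalabanUV.T4Continuum.G183FreePartRate` (one proof split over five ≤ 400-line files: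
`G183FreePartOneDim` §1–§2 → `G183FreePartSubordination` §3–§4 → `G183FreePartProducts` §5–§6 → `G183FreePartPieces` §7 →
`G183FreePartRate` §8 = the theorem and the full header: statement, proof outline, reading, sources).

§1: (U0) `|q_s(k)| ≤ e^{7/8}e^{−|k|}` (`s ≤ 1`), (U1) `|q_s(k)| ≤ s^{−1/2}(e^{−k²/8s} + e^{−|k|/8})` (`s ≥ 1`),
(U2) `|q_s(k) − φ_s(k)| ≤ C₂ s^{−3/2}(e^{−k²/16s} + e^{−|k|/16})` (`s ≥ 1`) from the tree's `abs_srwHeatKernel_le_exp`,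
`abs_srwHeatKernel_le_of_nonneg`, `srwHeatKernel_sub_gauss_core`.  §2: `l·φ_{2l²t}(k) = Φ_t(k/l)` and the physical forms
`abs_levelKer_le`, `abs_levelKer_sub_Phi_le` (rate `C₂/l²`), `abs_levelKer_le_small`.
-/

noncomputable section

open MeasureTheory Set Filter Real
open scoped Real Topology BigOperators

namespace Summit.QuantumFields.BalabanUV.T4Continuum.G183FreePartRate

open Literature.Probability.LatticeModels

/-! ## §1 One-dimensional inputs: the tree's Chernoff and local-limit bounds with ONE exponential weight kept -/

/-- `y² e^{-y/16} ≤ 512` for `y ≥ 0`. [folklore] -/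
theorem sq_mul_exp_neg_div_sixteen_le {y : ℝ} (hy : 0 ≤ y) : y ^ 2 * Real.exp (-(y / 16)) ≤ 512 := by
  have h := Real.pow_div_factorial_le_exp (hx := (by positivity : 0 ≤ y / 16)) (n := 2)
  have h2 : (y / 16) ^ 2 / (Nat.factorial 2) = y ^ 2 / 512 := by norm_num [Nat.factorial]; ring
  rw [h2, div_le_iff₀ (by norm_num : (0:ℝ) < 512)] at h
  have e3 : Real.exp (y / 16) * Real.exp (-(y / 16)) = 1 := by rw [← Real.exp_add]; simp
  calc y ^ 2 * Real.exp (-(y / 16)) ≤ 512 * Real.exp (y / 16) * Real.exp (-(y / 16)) := by gcongr; linarith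
    _ = 512 := by rw [mul_assoc, e3, mul_one]

/-- (U0) small times: `|q_s(k)| ≤ e^{7/8} e^{-|k|}` for `0 ≤ s ≤ 1` (shift `λ = 1`). [folklore] -/
theorem abs_srw_le_small {s : ℝ} (hs0 : 0 ≤ s) (hs1 : s ≤ 1) (k : ℤ) :
    |srwHeatKernel s k| ≤ Real.exp (7 / 8) * Real.exp (-(|k| : ℝ)) := by
  -- reduce to `k ≥ 0`
  wlog hk : 0 ≤ k generalizing k
  · have h := this (-k) (by omega)
    rw [srwHeatKernel_neg] at h
    simpa using h
  have h := abs_srwHeatKernel_le_exp hs0 k 1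
  have hmax : max 1 s = 1 := max_eq_left hs1
  rw [hmax, Real.one_rpow, mul_one] at h
  refine h.trans ?_
  rw [← Real.exp_add]
  refine Real.exp_le_exp.2 ?_
  have hc := cosh_sub_one_le (show |(1 : ℝ)| ≤ 1 by norm_num)
  have hc0 : 0 ≤ Real.cosh 1 - 1 := by linarith [Real.one_le_cosh (1:ℝ)]
  have : s * (Real.cosh 1 - 1) ≤ 7 / 8 := by nlinarith
  have hk' : (|k| : ℝ) = k := by exact_mod_cast abs_of_nonneg hk
  rw [hk']; linarith

/-- (U1) `s ≥ 1`: `|q_s(k)| ≤ s^{-1/2} (e^{-k²/(8s)} + e^{-|k|/8})` (Gaussian regime `|k| ≤ s`, Poisson regime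
`|k| > s`, the two Chernoff bounds of the tree added up). [folklore] -/
theorem abs_srw_le_large {s : ℝ} (hs : 1 ≤ s) (k : ℤ) :
    |srwHeatKernel s k| ≤
      s ^ (-(1 / 2 : ℝ)) * (Real.exp (-((k : ℝ) ^ 2 / (8 * s))) + Real.exp (-((|k| : ℝ) / 8))) := by
  wlog hk : 0 ≤ k generalizing k
  · have h := this (-k) (by omega)
    rw [srwHeatKernel_neg] at h
    simpa using h
  have hs0 : 0 < s := by linarith
  have hmax : max 1 s = s := max_eq_right hs
  have h := abs_srwHeatKernel_le_of_nonneg hs0 hk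
  rw [hmax] at h
  have hk' : (|k| : ℝ) = k := by exact_mod_cast abs_of_nonneg hk
  rw [hk']
  have hA : 0 ≤ Real.exp (-((k : ℝ) ^ 2 / (8 * s))) := (Real.exp_pos _).le
  have hB : 0 ≤ Real.exp (-((k : ℝ) / 8)) := (Real.exp_pos _).le
  have hS : 0 ≤ s ^ (-(1 / 2 : ℝ)) := Real.rpow_nonneg hs0.le _
  rcases le_or_gt (k : ℝ) s with hks | hks
  · calc |srwHeatKernel s k| ≤ Real.exp (-((k : ℝ) ^ 2 / (8 * s))) * s ^ (-(1 / 2 : ℝ)) := h.1 hks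
      _ ≤ _ := by nlinarith [mul_nonneg hS hB]
  · calc |srwHeatKernel s k| ≤ Real.exp (-((k : ℝ) / 8)) * s ^ (-(1 / 2 : ℝ)) := h.2 hks.le
      _ ≤ _ := by nlinarith [mul_nonneg hS hA]

/-- the constant of (U2). [folklore] -/
def C2 : ℝ := 512 * ((16 * Real.exp 5 * π ^ 6 + 2) + 8 * Real.exp 5 * π ^ 2) / (2 * π)

/-- `C₂ > 0`. [folklore] -/
theorem C2_pos : 0 < C2 := by unfold C2; positivity

/-- (U2) `s ≥ 1`: `|q_s(k) − φ_s(k)| ≤ C₂ s^{-3/2} (e^{-k²/(16 s)} + e^{-|k|/16})` — the tree's `srwHeatKernel_sub_gauss_core`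
with `λ = |k|/s` (`|k| ≤ s`) resp. `λ = 1` (`|k| > s`), half of the exponential traded against the polynomial prefactors.
[folklore] -/
theorem abs_srw_sub_gauss_le {s : ℝ} (hs : 1 ≤ s) (k : ℤ) :
    |srwHeatKernel s k - gaussHeatKernel s k| ≤
      C2 * s ^ (-(3 / 2 : ℝ)) * (Real.exp (-((k : ℝ) ^ 2 / (16 * s))) + Real.exp (-((|k| : ℝ) / 16))) := by
  wlog hk : 0 ≤ k generalizing k
  · have h := this (-k) (by omega)
    rw [srwHeatKernel_neg, Int.cast_neg, gaussHeatKernel_neg] at h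
    simpa using h
  have hs0 : 0 < s := by linarith
  have hπ := Real.pi_pos
  have hk0 : (0 : ℝ) ≤ k := by exact_mod_cast hk
  have hk' : (|k| : ℝ) = k := by exact_mod_cast abs_of_nonneg hk
  rw [hk']
  set K₂ : ℝ := 16 * Real.exp 5 * π ^ 6 + 2 with hK₂
  set K₃ : ℝ := 8 * Real.exp 5 * π ^ 2 with hK₃
  have hK₂0 : 0 < K₂ := by rw [hK₂]; positivity
  have hK₃0 : 0 < K₃ := by rw [hK₃]; positivity
  have hC2 : C2 = 512 * (K₂ + K₃) / (2 * π) := rfl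
  have hs32 : 0 < s ^ (-(3 / 2 : ℝ)) := Real.rpow_pos_of_pos hs0 _
  have hG : 0 ≤ Real.exp (-((k : ℝ) ^ 2 / (16 * s))) := (Real.exp_pos _).le
  have hP : 0 ≤ Real.exp (-((k : ℝ) / 16)) := (Real.exp_pos _).le
  -- `2π |q − φ| ≤ …` ⇒ `|q − φ| ≤ … / (2π)`
  have key : ∀ {R : ℝ}, 2 * π * |srwHeatKernel s k - gaussHeatKernel s k| ≤ R →
      |srwHeatKernel s k - gaussHeatKernel s k| ≤ R / (2 * π) := fun h => by
    rw [le_div_iff₀ (by positivity)]; linarith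
  rcases le_or_gt (k : ℝ) s with hks | hks
  · -- Gaussian regime, `λ = k/s`
    have hl0 : 0 ≤ (k : ℝ) / s := by positivity
    have hl1 : (k : ℝ) / s ≤ 1 := by rw [div_le_one hs0]; exact hks
    have h := srwHeatKernel_sub_gauss_core hs k hl0 hl1
    set y : ℝ := (k : ℝ) ^ 2 / s with hy
    have hy0 : 0 ≤ y := by positivity
    have e1 : -((k : ℝ) / s * k) + 7 / 8 * s * ((k : ℝ) / s) ^ 2 = -(y / 8) := by
      rw [hy]; field_simp; ring
    have e2 : ((k : ℝ) / s) ^ 4 * s ^ (1 / 2 : ℝ) = y ^ 2 * s ^ (-(3 / 2 : ℝ)) := by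
      have : ((k : ℝ) / s) ^ 4 = y ^ 2 * s ^ (-(2 : ℝ)) := by
        rw [hy, Real.rpow_neg hs0.le, show (2 : ℝ) = (2 : ℕ) by norm_num, Real.rpow_natCast]; field_simp
      rw [this, mul_assoc, ← Real.rpow_add hs0]; norm_num
    rw [e1] at h
    have h' : 2 * π * |srwHeatKernel s k - gaussHeatKernel s k| ≤
        Real.exp (-(y / 8)) * (K₂ + K₃ * y ^ 2) * s ^ (-(3 / 2 : ℝ)) := by
      refine h.trans (le_of_eq ?_)
      rw [show K₃ * ((k : ℝ) / s) ^ 4 * s ^ (1 / 2 : ℝ) = K₃ * (((k : ℝ) / s) ^ 4 * s ^ (1 / 2 : ℝ)) by ring, e2]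
      ring
    -- `e^{-y/8} (K₂ + K₃ y²) ≤ e^{-y/16} (K₂ + 512 K₃)`
    have hsplit : Real.exp (-(y / 8)) = Real.exp (-(y / 16)) * Real.exp (-(y / 16)) := by
      rw [← Real.exp_add]; congr 1; ring
    have hab : Real.exp (-(y / 16)) * (K₂ + K₃ * y ^ 2) ≤ K₂ + 512 * K₃ := by
      have h1 : Real.exp (-(y / 16)) ≤ 1 := by rw [Real.exp_le_one_iff]; linarith
      have h2 := sq_mul_exp_neg_div_sixteen_le hy0
      nlinarith [mul_nonneg hK₃0.le (mul_nonneg (sq_nonneg y) (Real.exp_pos (-(y/16))).le),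
        mul_le_mul_of_nonneg_left h1 hK₂0.le]
    have h'' : 2 * π * |srwHeatKernel s k - gaussHeatKernel s k| ≤
        (512 * (K₂ + K₃)) * s ^ (-(3 / 2 : ℝ)) * Real.exp (-(y / 16)) := by
      refine h'.trans ?_
      rw [hsplit]
      have : Real.exp (-(y / 16)) * Real.exp (-(y / 16)) * (K₂ + K₃ * y ^ 2) * s ^ (-(3 / 2 : ℝ)) =
          (Real.exp (-(y / 16)) * (K₂ + K₃ * y ^ 2)) * s ^ (-(3 / 2 : ℝ)) * Real.exp (-(y / 16)) := by ring
      rw [this]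
      have hKK : K₂ + 512 * K₃ ≤ 512 * (K₂ + K₃) := by nlinarith
      exact mul_le_mul_of_nonneg_right (mul_le_mul_of_nonneg_right (hab.trans hKK) hs32.le)
        (Real.exp_pos _).le
    have ey : Real.exp (-(y / 16)) = Real.exp (-((k : ℝ) ^ 2 / (16 * s))) := by
      rw [hy]; congr 1; field_simp
    calc |srwHeatKernel s k - gaussHeatKernel s k|
        ≤ (512 * (K₂ + K₃)) * s ^ (-(3 / 2 : ℝ)) * Real.exp (-(y / 16)) / (2 * π) := key h''
      _ = C2 * s ^ (-(3 / 2 : ℝ)) * Real.exp (-((k : ℝ) ^ 2 / (16 * s))) := by rw [hC2, ey]; ring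
      _ ≤ _ := mul_le_mul_of_nonneg_left (le_add_of_nonneg_right hP) (mul_nonneg C2_pos.le hs32.le)
  · -- Poisson regime, `λ = 1`
    have h := srwHeatKernel_sub_gauss_core hs k (le_refl (0:ℝ) |>.trans zero_le_one) le_rfl
    have hk1 : (1 : ℝ) ≤ k := by linarith
    have e1 : Real.exp (-(1 * (k : ℝ)) + 7 / 8 * s * 1 ^ 2) ≤ Real.exp (-((k : ℝ) / 8)) :=
      Real.exp_le_exp.2 (by linarith)
    -- `K₂ s^{-3/2} + K₃ s^{1/2} ≤ (K₂ + K₃) k² s^{-3/2}`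
    have hs12 : s ^ (1 / 2 : ℝ) = s ^ 2 * s ^ (-(3 / 2 : ℝ)) := by
      rw [← Real.rpow_natCast s 2, ← Real.rpow_add hs0]; norm_num
    have hsk : s ^ 2 ≤ (k : ℝ) ^ 2 := pow_le_pow_left₀ hs0.le hks.le 2
    have hone : (1 : ℝ) ≤ (k : ℝ) ^ 2 := by nlinarith
    have hbr : K₂ * s ^ (-(3 / 2 : ℝ)) + K₃ * 1 ^ 4 * s ^ (1 / 2 : ℝ) ≤
        (K₂ + K₃) * (k : ℝ) ^ 2 * s ^ (-(3 / 2 : ℝ)) := by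
      rw [one_pow, mul_one, hs12]
      nlinarith [mul_le_mul_of_nonneg_left hsk (mul_nonneg hK₃0.le hs32.le),
        mul_le_mul_of_nonneg_left hone (mul_nonneg hK₂0.le hs32.le)]
    have h' : 2 * π * |srwHeatKernel s k - gaussHeatKernel s k| ≤
        Real.exp (-((k : ℝ) / 8)) * ((K₂ + K₃) * (k : ℝ) ^ 2 * s ^ (-(3 / 2 : ℝ))) :=
      h.trans (mul_le_mul e1 hbr (by positivity) (by positivity))
    have hsplit : Real.exp (-((k : ℝ) / 8)) = Real.exp (-((k : ℝ) / 16)) * Real.exp (-((k : ℝ) / 16)) := by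
      rw [← Real.exp_add]; congr 1; ring
    have hab : (k : ℝ) ^ 2 * Real.exp (-((k : ℝ) / 16)) ≤ 512 := sq_mul_exp_neg_div_sixteen_le hk0
    have h'' : 2 * π * |srwHeatKernel s k - gaussHeatKernel s k| ≤
        (512 * (K₂ + K₃)) * s ^ (-(3 / 2 : ℝ)) * Real.exp (-((k : ℝ) / 16)) := by
      refine h'.trans ?_
      rw [hsplit]
      have : Real.exp (-((k : ℝ) / 16)) * Real.exp (-((k : ℝ) / 16)) * ((K₂ + K₃) * (k : ℝ) ^ 2 * s ^ (-(3 / 2 : ℝ)))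
          = ((k : ℝ) ^ 2 * Real.exp (-((k : ℝ) / 16))) * ((K₂ + K₃) * s ^ (-(3 / 2 : ℝ)) * Real.exp (-((k : ℝ) / 16))) := by
        ring
      rw [this]
      have hrest : 0 ≤ (K₂ + K₃) * s ^ (-(3 / 2 : ℝ)) * Real.exp (-((k : ℝ) / 16)) := by positivity
      nlinarith
    calc |srwHeatKernel s k - gaussHeatKernel s k|
        ≤ (512 * (K₂ + K₃)) * s ^ (-(3 / 2 : ℝ)) * Real.exp (-((k : ℝ) / 16)) / (2 * π) := key h''
      _ = C2 * s ^ (-(3 / 2 : ℝ)) * Real.exp (-((k : ℝ) / 16)) := by rw [hC2]; ring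
      _ ≤ _ := mul_le_mul_of_nonneg_left (le_add_of_nonneg_left hG) (mul_nonneg C2_pos.le hs32.le)


/-! ## §2 Level-`l` kernels in physical variables -/

/-- the LEVEL-FREE Gaussian `Φ_t(ρ) = e^{−ρ²/(4t)}/√(4πt)`: `l · φ_{2l²t}(lρ) = Φ_t(ρ)` for every level `l`. [folklore] -/
def Phi (t ρ : ℝ) : ℝ := Real.exp (-(ρ ^ 2 / (4 * t))) / Real.sqrt (4 * π * t)

/-- `l · φ_{2l²t}(k) = Φ_t(k/l)`. [folklore] -/
theorem level_gauss {l : ℝ} (hl : 0 < l) {t : ℝ} (ht : 0 < t) (k : ℝ) :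
    l * gaussHeatKernel (2 * l ^ 2 * t) k = Phi t (k / l) := by
  unfold gaussHeatKernel Phi
  have hs : Real.sqrt (2 * π * (2 * l ^ 2 * t)) = l * Real.sqrt (4 * π * t) := by
    rw [show 2 * π * (2 * l ^ 2 * t) = l ^ 2 * (4 * π * t) by ring, Real.sqrt_mul (sq_nonneg l),
      Real.sqrt_sq hl.le]
  have e : k ^ 2 / (2 * (2 * l ^ 2 * t)) = (k / l) ^ 2 / (4 * t) := by field_simp; ring
  rw [hs, e]
  have hsq : 0 < Real.sqrt (4 * π * t) := Real.sqrt_pos.2 (by positivity)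
  field_simp

/-- `l · (2l²t)^{-1/2} = (2t)^{-1/2}`. [folklore] -/
theorem level_rpow_half {l : ℝ} (hl : 0 < l) {t : ℝ} (ht : 0 < t) :
    l * (2 * l ^ 2 * t) ^ (-(1 / 2 : ℝ)) = (2 * t) ^ (-(1 / 2 : ℝ)) := by
  rw [show 2 * l ^ 2 * t = l ^ 2 * (2 * t) by ring,
    Real.mul_rpow (sq_nonneg l) (by positivity : (0:ℝ) ≤ 2 * t), ← Real.rpow_natCast l 2,
    ← Real.rpow_mul hl.le]
  norm_num
  rw [Real.rpow_neg_one]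
  field_simp

/-- `l · (2l²t)^{-3/2} = (2t)^{-3/2} / l²`. [folklore] -/
theorem level_rpow_threehalf {l : ℝ} (hl : 0 < l) {t : ℝ} (ht : 0 < t) :
    l * (2 * l ^ 2 * t) ^ (-(3 / 2 : ℝ)) = (2 * t) ^ (-(3 / 2 : ℝ)) / l ^ 2 := by
  rw [show 2 * l ^ 2 * t = l ^ 2 * (2 * t) by ring,
    Real.mul_rpow (sq_nonneg l) (by positivity : (0:ℝ) ≤ 2 * t), ← Real.rpow_natCast l 2,
    ← Real.rpow_mul hl.le]
  norm_num
  field_simp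

/-- `2l²t ≥ 1 ⇒ t > 0`. [folklore] -/
theorem pos_of_one_le_level {l : ℝ} {t : ℝ} (ht : 1 ≤ 2 * l ^ 2 * t) : 0 < t := by
  by_contra h
  push Not at h
  nlinarith [sq_nonneg l, mul_nonneg (mul_nonneg (by norm_num : (0:ℝ) ≤ 2) (sq_nonneg l)) (neg_nonneg.2 h)]

/-- level-`l` kernel, `2l²t ≥ 1`: `|l q_{2l²t}(k)| ≤ (2t)^{-1/2}(e^{-(k/l)²/(16t)} + e^{-|k|/8})`. [folklore] -/
theorem abs_levelKer_le {l : ℕ} (hl : 1 ≤ l) {t : ℝ} (ht : 1 ≤ 2 * (l : ℝ) ^ 2 * t) (k : ℤ) :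
    |(l : ℝ) * srwHeatKernel (2 * (l : ℝ) ^ 2 * t) k| ≤
      (2 * t) ^ (-(1 / 2 : ℝ)) *
        (Real.exp (-(((k : ℝ) / l) ^ 2 / (16 * t))) + Real.exp (-((|k| : ℝ) / 8))) := by
  have hl0 : (0 : ℝ) < l := by exact_mod_cast hl
  have ht0 : 0 < t := pos_of_one_le_level ht
  have h := abs_srw_le_large ht k
  have e1 : (k : ℝ) ^ 2 / (8 * (2 * (l : ℝ) ^ 2 * t)) = ((k : ℝ) / l) ^ 2 / (16 * t) := by
    field_simp; ring
  rw [e1] at h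
  rw [abs_mul, abs_of_pos hl0]
  calc (l : ℝ) * |srwHeatKernel (2 * (l : ℝ) ^ 2 * t) k|
      ≤ (l : ℝ) * ((2 * (l : ℝ) ^ 2 * t) ^ (-(1 / 2 : ℝ)) *
          (Real.exp (-(((k : ℝ) / l) ^ 2 / (16 * t))) + Real.exp (-((|k| : ℝ) / 8)))) :=
        mul_le_mul_of_nonneg_left h hl0.le
    _ = _ := by rw [← mul_assoc, level_rpow_half hl0 ht0]

/-- level-`l` kernel minus the level-free Gaussian, `2l²t ≥ 1`:
`|l q_{2l²t}(k) − Φ_t(k/l)| ≤ (C₂/l²)(2t)^{-3/2}(e^{-(k/l)²/(32t)} + e^{-|k|/16})` — the `l^{-2} = η²` RATE. [folklore] -/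
theorem abs_levelKer_sub_Phi_le {l : ℕ} (hl : 1 ≤ l) {t : ℝ} (ht : 1 ≤ 2 * (l : ℝ) ^ 2 * t) (k : ℤ) :
    |(l : ℝ) * srwHeatKernel (2 * (l : ℝ) ^ 2 * t) k - Phi t ((k : ℝ) / l)| ≤
      C2 / (l : ℝ) ^ 2 * (2 * t) ^ (-(3 / 2 : ℝ)) *
        (Real.exp (-(((k : ℝ) / l) ^ 2 / (32 * t))) + Real.exp (-((|k| : ℝ) / 16))) := by
  have hl0 : (0 : ℝ) < l := by exact_mod_cast hl
  have ht0 : 0 < t := pos_of_one_le_level ht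
  have h := abs_srw_sub_gauss_le ht k
  have e1 : (k : ℝ) ^ 2 / (16 * (2 * (l : ℝ) ^ 2 * t)) = ((k : ℝ) / l) ^ 2 / (32 * t) := by
    field_simp; ring
  rw [e1] at h
  rw [← level_gauss hl0 ht0, ← mul_sub, abs_mul, abs_of_pos hl0]
  calc (l : ℝ) * |srwHeatKernel (2 * (l : ℝ) ^ 2 * t) k - gaussHeatKernel (2 * (l : ℝ) ^ 2 * t) k|
      ≤ (l : ℝ) * (C2 * (2 * (l : ℝ) ^ 2 * t) ^ (-(3 / 2 : ℝ)) *
          (Real.exp (-(((k : ℝ) / l) ^ 2 / (32 * t))) + Real.exp (-((|k| : ℝ) / 16)))) :=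
        mul_le_mul_of_nonneg_left h hl0.le
    _ = _ := by
        rw [show ∀ A W : ℝ, (l : ℝ) * (C2 * A * W) = C2 * ((l : ℝ) * A) * W from fun A W => by ring,
          level_rpow_threehalf hl0 ht0]
        ring

/-- level-`l` kernel at SMALL times `2l²t ≤ 1`: `|l q_{2l²t}(k)| ≤ l e^{7/8} e^{-|k|}` (no cancellation is used there).
[folklore] -/
theorem abs_levelKer_le_small {l : ℕ} (hl : 1 ≤ l) {t : ℝ} (ht0 : 0 ≤ t) (ht : 2 * (l : ℝ) ^ 2 * t ≤ 1) (k : ℤ) :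
    |(l : ℝ) * srwHeatKernel (2 * (l : ℝ) ^ 2 * t) k| ≤ (l : ℝ) * (Real.exp (7 / 8) * Real.exp (-(|k| : ℝ))) := by
  have hl0 : (0 : ℝ) < l := by exact_mod_cast hl
  rw [abs_mul, abs_of_pos hl0]
  exact mul_le_mul_of_nonneg_left (abs_srw_le_small (by positivity) ht k) hl0.le

end Summit.QuantumFields.BalabanUV.T4Continuum.G183FreePartRate
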